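import Summits.Ventures.PercRepro.Night2OneFatSources

/-!
# PercRepro — the face closures of the sources of a one-coloop target meet in the base plane (night-2, gen 29)

Let `S ⊆ G` with `S ∖ K` of rank `5`, and `y₁, y₂, y₃ ∈ S ∖ K` three points, none a coloop of `S ∖ K`, with `y₂, y₃` coloops of
`(S ∖ K) ∖ y₁` (the structure of a source `y₁`: its erasure has coloops `w, y₂, y₃`).  Put `P = S ∖ {y₁, y₂, y₃}` (the line
part, the coloop `w` and `K`; `P ∖ K` has rank `3`).  The face closures of the sources are `H′_a = cl (P ∪ {y_a})` (the face
of `S ∖ y_b` at `y_c`), of rank `5`, and **two of them meet only in `cl P`**: a point `x` of `cl (P ∪ y₁) ∩ cl (P ∪ y₂)` off `cl P`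
would span `cl (P ∪ y₁)` and `cl (P ∪ y₂)` together with `P`, so `y₁, y₂ ∈ cl (P ∪ x)` and `S ∖ y₃ ⊆ cl (P ∪ x)` would have rank
`≤ 4` — but `y₃` is no coloop of `S ∖ K`.  This is the geometric input (P1) of the case-1 finite check (proofs/NIGHT-2-g29.md
§4′(c), §4‴ L5): an outside point in two of the three face closures `H′_a` lies in all three.

* `rkN_sdiff_two_coloops`, `notMem_clF_base`, **`mem_clF_base_of_mem_two_faces`**, `mem_clF_third_face_of_mem_two`.
-/

namespace PercRepro.Shadow

open Finset PerFlat ThmH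

variable {α : Type*} [DecidableEq α] {M : Matroid α} [M.Finite]

section CaseOneGeomB

/-- A point of `V` that is not a coloop leaves the rank unchanged when erased. -/
theorem rkN_erase_of_not_coloop {V : Finset α} (hVg : V ⊆ gr M) {a : α} (ha : a ∈ V) (haV : a ∉ coloops M V) :
    rkN M (V.erase a) = rkN M V := by
  have hacl : a ∈ clF M (V.erase a) := by
    by_contra hn
    exact haV (mem_coloops.2 ⟨ha, hn⟩)
  have h1 := rkN_insert_le_of_mem_clF (M := M) ((Finset.erase_subset _ _).trans hVg) hacl
  rw [Finset.insert_erase ha] at h1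
  have h2 : rkN M (V.erase a) ≤ rkN M V := rkN_mono (Finset.erase_subset _ _)
  omega

/-- **Two face closures meet only in the closure of the base** (off `K`): `V` of rank `5`, `y₁, y₂, y₃ ∈ V` distinct, none a
coloop of `V`, `y₂, y₃` coloops of `V ∖ y₁`; `P′ = V ∖ {y₁, y₂, y₃}`.  A point `x ∈ cl (P′ ∪ y₁) ∩ cl (P′ ∪ y₂)` lies in `cl P′`. -/
theorem mem_clF_base_of_mem_two_faces {V : Finset α} (hVg : V ⊆ gr M) (hV5 : rkN M V = 5) {y₁ y₂ y₃ : α}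
    (hy₁ : y₁ ∈ V) (hy₂ : y₂ ∈ V) (hy₃ : y₃ ∈ V) (h12 : y₁ ≠ y₂) (h13 : y₁ ≠ y₃) (h23 : y₂ ≠ y₃)
    (hc₃ : y₃ ∉ coloops M V) (hcol₂ : y₂ ∈ coloops M (V.erase y₁)) (hcol₃ : y₃ ∈ coloops M (V.erase y₁))
    {x : α} (hxg : x ∈ gr M)
    (hx₁ : x ∈ clF M (insert y₁ (((V.erase y₁).erase y₂).erase y₃)))
    (hx₂ : x ∈ clF M (insert y₂ (((V.erase y₁).erase y₂).erase y₃))) :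
    x ∈ clF M (((V.erase y₁).erase y₂).erase y₃) := by
  set P := ((V.erase y₁).erase y₂).erase y₃ with hP
  have hPg : P ⊆ gr M := ((Finset.erase_subset _ _).trans ((Finset.erase_subset _ _).trans
    (Finset.erase_subset _ _))).trans hVg
  -- `rk (V ∖ y₁) = 5`, `rk P = 3`
  have hQ5 : rkN M (V.erase y₁) = 5 := by
    -- `y₁` is not a coloop of `V`: it is in `V ∖ … `?  We only know `y₃ ∉ coloops`; derive `rk (V ∖ y₁) = 5` from the coloops `y₂, y₃`:
    -- `y₂` is a coloop of `V ∖ y₁`, so `rk (V ∖ y₁) = rk ((V ∖ y₁) ∖ y₂) + 1 ≥ …`; use instead `rk (V ∖ y₁) ≥ rk (V ∖ y₃) − …`.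
    -- Direct route: `V ∖ y₃` has rank `5` (`y₃` no coloop) and `V ∖ y₃ ⊆ insert y₂ (insert y₁ P)`; also
    -- `rk (V ∖ y₁) ≥ rk ((V ∖ y₁) ∖ y₃) + 1` … we give the clean argument below via `hQ3`.
    have h1 := rkN_erase_of_not_coloop hVg hy₃ hc₃
    rw [hV5] at h1
    -- `V ∖ y₃ = insert y₂ (insert y₁ P)` and `insert y₁ P ⊆ V ∖ y₂` hmm; simplest: `rk (V ∖ y₁) ≥ 5` since
    -- `(V ∖ y₁) ∖ y₃` has rank `rk (V ∖ y₁) − 1` and `V ∖ y₃ = insert y₁ ((V ∖ y₁) ∖ y₃)` has rank `≤ rk ((V∖y₁)∖y₃) + 1`.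
    have h2 : rkN M (V.erase y₁) = rkN M ((V.erase y₁).erase y₃) + 1 :=
      rkN_erase_of_mem_coloops (M := M) ((Finset.erase_subset _ _).trans hVg) hcol₃
    have h3 : rkN M (V.erase y₃) ≤ rkN M ((V.erase y₁).erase y₃) + 1 := by
      have heq : V.erase y₃ = insert y₁ ((V.erase y₁).erase y₃) := by
        rw [Finset.erase_right_comm, Finset.insert_erase (Finset.mem_erase.2 ⟨h13, hy₁⟩)]
      rw [heq]
      by_cases hcl : y₁ ∈ clF M ((V.erase y₁).erase y₃)
      · have := rkN_insert_le_of_mem_clF (M := M) ((Finset.erase_subset _ _).trans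
          ((Finset.erase_subset _ _).trans hVg)) hcl
        omega
      · have := rkN_insert_of_notMem_clF (M := M) (hVg hy₁) hcl
        omega
    have h4 : rkN M (V.erase y₁) ≤ 5 := by rw [← hV5]; exact rkN_mono (Finset.erase_subset _ _)
    omega
  have hcol₃' : y₃ ∈ coloops M ((V.erase y₁).erase y₂) := mem_coloops_erase_of_mem_coloops hcol₃ h23.symm
  have hP3 : rkN M P = 3 := by
    have h1 : rkN M (V.erase y₁) = rkN M ((V.erase y₁).erase y₂) + 1 :=
      rkN_erase_of_mem_coloops (M := M) ((Finset.erase_subset _ _).trans hVg) hcol₂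
    have h2 : rkN M ((V.erase y₁).erase y₂) = rkN M P + 1 :=
      rkN_erase_of_mem_coloops (M := M) ((Finset.erase_subset _ _).trans
        ((Finset.erase_subset _ _).trans hVg)) hcol₃'
    rw [hQ5] at h1
    omega
  -- `V ∖ y₃ = insert y₁ (insert y₂ P)` has rank `5`
  have hV3 : rkN M (insert y₁ (insert y₂ P)) = 5 := by
    have heq : insert y₁ (insert y₂ P) = V.erase y₃ := by
      rw [hP]
      ext a
      simp only [Finset.mem_insert, Finset.mem_erase]
      constructor
      · rintro (rfl | rfl | ⟨ha3, ha2, ha1, haV⟩)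
        · exact ⟨h13, hy₁⟩
        · exact ⟨h23, hy₂⟩
        · exact ⟨ha3, haV⟩
      · rintro ⟨ha3, haV⟩
        by_cases h1 : a = y₁
        · exact Or.inl h1
        · by_cases h2 : a = y₂
          · exact Or.inr (Or.inl h2)
          · exact Or.inr (Or.inr ⟨ha3, h2, h1, haV⟩)
    rw [heq, rkN_erase_of_not_coloop hVg hy₃ hc₃, hV5]
  by_contra hxP
  -- `rk (insert x P) = 4` and `insert x P ⊆ cl (insert y₁ P)` of rank `≤ 4`: `y₁ ∈ cl (insert x P)`; same for `y₂`
  have hxr := rkN_insert_of_notMem_clF (M := M) hxg hxP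
  rw [hP3] at hxr
  have hface : ∀ y ∈ V, x ∈ clF M (insert y P) → y ∈ clF M (insert x P) := by
    intro y hyV hxy
    have hsub : insert x P ⊆ clF M (insert y P) :=
      Finset.insert_subset hxy ((Finset.subset_insert _ _).trans
        (subset_clF_of_subset_gr (Finset.insert_subset (hVg hyV) hPg)))
    have hr : rkN M (insert y P) ≤ 4 := by
      by_cases hcl : y ∈ clF M P
      · have := rkN_insert_le_of_mem_clF (M := M) hPg hcl; omega
      · have := rkN_insert_of_notMem_clF (M := M) (hVg hyV) hcl; omega
    have hrcl : rkN M (clF M (insert y P)) ≤ 4 := by rw [rkN_clF]; exact hr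
    have hr4 : rkN M (clF M (insert y P)) = 4 := by
      have := rkN_mono (M := M) hsub
      omega
    have hclg : clF M (insert y P) ⊆ gr M := by
      rw [← Finset.coe_subset, coe_clF, coe_gr]
      exact M.closure_subset_ground _
    exact mem_clF_of_rkN_eq hsub hclg (by rw [hr4, hxr]) (subset_clF_of_subset_gr
      (Finset.insert_subset (hVg hyV) hPg) (Finset.mem_insert_self _ _))
  have hy₁x := hface y₁ hy₁ hx₁
  have hy₂x := hface y₂ hy₂ hx₂
  -- then `insert y₁ (insert y₂ P) ⊆ cl (insert x P)`, of rank `4 < 5`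
  have hsub : insert y₁ (insert y₂ P) ⊆ clF M (insert x P) :=
    Finset.insert_subset hy₁x (Finset.insert_subset hy₂x ((Finset.subset_insert _ _).trans
      (subset_clF_of_subset_gr (Finset.insert_subset hxg hPg))))
  have h := rkN_mono (M := M) hsub
  rw [rkN_clF, hxr, hV3] at h
  omega

/-- **An outside point in two face closures lies in the third** (off `K`): `x ∈ cl (P′ ∪ y₁) ∩ cl (P′ ∪ y₂)` ⇒ `x ∈ cl (P′ ∪ y₃)`. -/
theorem mem_clF_third_face_of_mem_two {V : Finset α} (hVg : V ⊆ gr M) (hV5 : rkN M V = 5) {y₁ y₂ y₃ : α}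
    (hy₁ : y₁ ∈ V) (hy₂ : y₂ ∈ V) (hy₃ : y₃ ∈ V) (h12 : y₁ ≠ y₂) (h13 : y₁ ≠ y₃) (h23 : y₂ ≠ y₃)
    (hc₃ : y₃ ∉ coloops M V) (hcol₂ : y₂ ∈ coloops M (V.erase y₁)) (hcol₃ : y₃ ∈ coloops M (V.erase y₁))
    {x : α} (hxg : x ∈ gr M)
    (hx₁ : x ∈ clF M (insert y₁ (((V.erase y₁).erase y₂).erase y₃)))
    (hx₂ : x ∈ clF M (insert y₂ (((V.erase y₁).erase y₂).erase y₃))) :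
    x ∈ clF M (insert y₃ (((V.erase y₁).erase y₂).erase y₃)) :=
  clF_mono (Finset.subset_insert _ _)
    (mem_clF_base_of_mem_two_faces hVg hV5 hy₁ hy₂ hy₃ h12 h13 h23 hc₃ hcol₂ hcol₃ hxg hx₁ hx₂)

end CaseOneGeomB

end PercRepro.Shadow
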